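import Literature.NumberTheory.EllipticCurves.AbelianVarietyModelOfAddHom
import Literature.AlgebraicGeometry.Motives.AlgPointsSeparate
import HarnessLib

/-!
# Translations of a Weierstrass cubic by rational points, as automorphisms of the `K`-scheme

Let `W` be an elliptic curve over a field `K`, `E_W ⊂ ℙ²_K` its plane cubic with an addition morphism
`add : E_W ×_K E_W → E_W` restricting to the chord–tangent law on `K̄`-points (the hypothesis `hadd` of
`EllipticCurves/AbelianVarietyModelOfAddHom`; supplied by `EllipticCurves/WeierstrassAddLawCharts`).
For a `K`-RATIONAL point `R ∈ W(K)` the translation `τ_R : E_W → E_W`, `P ↦ P + R`, is the `K`-morphism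
`(𝟙, R) ≫ add` (Silverman, *AEC* III.3.6: translations are morphisms, indeed isomorphisms with inverse
`τ_{-R}`). This file constructs it and proves:

* `WeierstrassCurve.sectionOfPoint R : Spec K → E_W` — the section of a `K`-rational point, with its value
  on `L`-points (`toUnit_comp_sectionOfPoint`: the point `R` read in `W(L)`);
* `WeierstrassCurve.transl add R : E_W → E_W` over `K` and `toGeomPoint_comp_transl`: **on `K̄`-points it
  is `P ↦ P + R`**;
* `transl_comp_transl_neg : τ_R ≫ τ_{-R} = 𝟙` (equal on `K̄`-points, `Motives/AlgPointsSeparate`), hence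
  `τ_R` is an isomorphism (`isIso_transl_left`) and composing an open immersion with it stays an open
  immersion — the device by which a morphism given by a formula off finitely many points is extended
  across them (`EllipticCurves/WeierstrassMapAtlas`).

## References

* J. H. Silverman, *The Arithmetic of Elliptic Curves*, 2nd ed., GTM 106 (2009): III.2, III.3.6.
  [SilvermanAEC2009]
* D. Mumford, *Abelian Varieties* (1970), §4 (translations `T_x`). [MumfordAV1970]

## Design

`namespace WeierstrassCurve`; the addition morphism is a parameter `(add, hadd)` exactly as in
`abelianVarietyOfAddHom`, so that the results apply to every abelian-variety model built that way
(e.g. `WeilSquare.curveAV`). No named facts.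
-/

noncomputable section

open CategoryTheory AlgebraicGeometry MonoidalCategory CartesianMonoidalCategory Limits
open Literature.AlgebraicGeometry.Motives Literature.NumberTheory.EllipticCurves

universe u

-- tree idiom for scheme-level rewriting through `Over`/pullback API (cf. `WeierstrassAddAtlas`)
set_option backward.isDefEq.respectTransparency false

namespace WeierstrassCurve

variable {K : Type u} [Field K] (W : WeierstrassCurve K) [W.IsElliptic]

local notation "K̄" => AlgebraicClosure K

/-! ### Sections of `K`-rational points -/

section Section

open scoped Classical

/-- The `K`-point of `E_W` underlying a `K`-rational point `R ∈ W(K)`: `O ↦ [0 : 1 : 0]`,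
`(x, y) ↦ [x : y : 1]` (Silverman, *AEC* III.2). [cite: SilvermanAEC2009, III.2] -/
def ratPoint : (W.baseChange K).toAffine.Point → AlgPoints W.scheme K
  | 0 => W.unitPoint
  | .some x y h => W.schemePoint ![x, y, 1] (fin3_one_ne_zero x y) ((Projective.equation_some x y).mpr h.1)

omit [W.IsElliptic] in
/-- `ratPoint O = [0 : 1 : 0]`. [folklore] -/
theorem ratPoint_zero : W.ratPoint 0 = W.unitPoint := rfl

omit [W.IsElliptic] in
/-- `ratPoint (x, y) = [x : y : 1]`. [folklore] -/
theorem ratPoint_some {x y : K} (h : (W.baseChange K).toAffine.Nonsingular x y) :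
    W.ratPoint (.some x y h) =
      W.schemePoint ![x, y, 1] (fin3_one_ne_zero x y) ((Projective.equation_some x y).mpr h.1) := rfl

variable (R : (W.baseChange K).toAffine.Point)

omit [W.IsElliptic] in
/-- **The section `Spec K → E_W` of a `K`-rational point `R ∈ W(K)`** (as a morphism from the monoidal
unit of `Over (Spec K)`; Silverman, *AEC* III.2). [cite: SilvermanAEC2009, III.2] -/
def sectionOfPoint : 𝟙_ (SchemeOver K) ⟶ W.scheme :=
  Over.homMk (W.ratPoint R).left <| by
    refine (Over.w (W.ratPoint R)).trans ?_
    change Spec.map (CommRingCat.ofHom (algebraMap K K)) = 𝟙 (Spec (CommRingCat.of K))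
    rw [Algebra.algebraMap_self, CommRingCat.ofHom_id]
    exact Spec.map_id _

omit [W.IsElliptic] in
/-- The underlying morphism of `sectionOfPoint R` is that of the `K`-point `R`. [folklore] -/
theorem sectionOfPoint_left : (W.sectionOfPoint R).left = (W.ratPoint R).left := rfl

/-- The point `R ∈ W(K)` read in `W(L)` for a field extension `L/K` (Mathlib `Affine.Point.map`).
[cite: SilvermanAEC2009, III.2] -/
abbrev pointIn (L : Type u) [Field L] [Algebra K L] : (W.baseChange L).toAffine.Point :=
  Affine.Point.map (Algebra.ofId K L) R

/-- The point `R ∈ W(K)` read as a geometric point `R ∈ W(K̄) = W.geomPoints`. [cite: SilvermanAEC2009, III.2] -/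
abbrev geomPointIn : W.geomPoints := W.pointIn R (AlgebraicClosure K)

omit [W.IsElliptic] in
/-- `R ↦ R ∈ W(K̄)` is additive: `(-R) = -R` in `W(K̄)`. [folklore] -/
theorem geomPointIn_neg : W.geomPointIn (-R) = -W.geomPointIn R := map_neg _ _

omit [W.IsElliptic] in
/-- `R ↦ R ∈ W(K̄)` is additive. [folklore] -/
theorem geomPointIn_add (R' : (W.baseChange K).toAffine.Point) :
    W.geomPointIn (R + R') = W.geomPointIn R + W.geomPointIn R' := map_add _ _ _

variable (L : Type u) [Field L] [Algebra K L]

/-- **The value of the section of `R` on `L`-points is `R ∈ W(L)`.** [cite: SilvermanAEC2009, III.2] -/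
theorem toUnit_comp_sectionOfPoint :
    toUnit (specOver K L) ≫ W.sectionOfPoint R = W.pointEquiv (L := L) (W.pointIn R L) := by
  have h1 : toUnit (specOver K L) ≫ W.sectionOfPoint R =
      specOverOfAlgHom (Algebra.ofId K L) ≫ W.ratPoint R :=
    Over.OverMorphism.ext (by
      rw [Over.comp_left, Over.comp_left, sectionOfPoint_left, Over.toUnit_left, specOverOfAlgHom_left]
      rfl)
  rw [h1]
  rcases R with _ | ⟨x, y, h⟩
  · rw [← Affine.Point.zero_def, ratPoint_zero, unitPoint, specOverOfAlgHom_comp_schemePoint,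
      show W.pointIn 0 L = 0 from map_zero _, pointEquiv_zero]
    congr 1
    funext j
    fin_cases j <;> simp
  · rw [ratPoint_some, specOverOfAlgHom_comp_schemePoint]
    change _ = W.pointEquiv (Affine.Point.some _ _ _)
    rw [pointEquiv_some]
    congr 1
    funext j
    fin_cases j <;> simp [Algebra.ofId_apply]

end Section

/-! ### Translations -/

section Transl

variable (add : W.scheme ⊗ W.scheme ⟶ W.scheme)
  (hadd : ∀ P Q : W.geomPoints, lift (W.pointEquiv (L := AlgebraicClosure K) P)
    (W.pointEquiv (L := AlgebraicClosure K) Q) ≫ add = W.pointEquiv (L := AlgebraicClosure K) (P + Q))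
  (R : (W.baseChange K).toAffine.Point)

/-- **The translation `τ_R = (𝟙, R) ≫ add : E_W → E_W` by a `K`-rational point `R`** (Silverman,
*AEC* III.3.6; Mumford §4, `T_x`). [cite: SilvermanAEC2009, III.3.6] -/
def transl : W.scheme ⟶ W.scheme :=
  lift (𝟙 W.scheme) (toUnit W.scheme ≫ W.sectionOfPoint R) ≫ add

include hadd in
/-- **`τ_R` is `P ↦ P + R` on `K̄`-points.** [cite: SilvermanAEC2009, III.3.6] -/
theorem toGeomPoint_comp_transl (p : AlgPoints W.scheme K̄) :
    W.toGeomPoint (p ≫ W.transl add R) = W.toGeomPoint p + W.geomPointIn R := by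
  have hp : p ≫ W.transl add R = lift p (toUnit (specOver K K̄) ≫ W.sectionOfPoint R) ≫ add := by
    rw [transl, ← Category.assoc, comp_lift, Category.comp_id, ← Category.assoc, toUnit_unique
      (p ≫ toUnit W.scheme) (toUnit (specOver K K̄))]
  rw [hp, W.toGeomPoint_lift_comp add hadd, toUnit_comp_sectionOfPoint, toGeomPoint_pointEquiv]

include hadd in
/-- `[P] ≫ τ_R = [P + R]`. [cite: SilvermanAEC2009, III.3.6] -/
theorem pointEquiv_comp_transl (P : W.geomPoints) :
    W.pointEquiv (L := K̄) P ≫ W.transl add R = W.pointEquiv (L := K̄) (P + W.geomPointIn R) := by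
  have h := W.toGeomPoint_comp_transl add hadd R (W.pointEquiv (L := K̄) P)
  rw [toGeomPoint_pointEquiv] at h
  rw [← W.pointEquiv_toGeomPoint (W.pointEquiv (L := K̄) P ≫ W.transl add R), h]

include hadd in
/-- **`τ_R ≫ τ_{-R} = 𝟙`**: the two sides agree on `K̄`-points (`P + R - R = P`) and `E_W` is reduced of
finite type and separated over `K` (`Motives/AlgPointsSeparate`). [cite: SilvermanAEC2009, III.3.6] -/
theorem transl_comp_transl_neg : W.transl add R ≫ W.transl add (-R) = 𝟙 W.scheme := by
  haveI : IsReduced W.scheme.left := W.isReduced_scheme_left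
  refine SchemeOver.hom_ext_of_forall_algPoints (AlgebraicClosure K) fun p ↦ ?_
  apply W.toGeomPoint_bijective.1
  rw [Category.comp_id, ← Category.assoc, W.toGeomPoint_comp_transl add hadd,
    W.toGeomPoint_comp_transl add hadd, geomPointIn_neg, add_neg_cancel_right]

include hadd in
/-- `τ_{-R} ≫ τ_R = 𝟙`. [cite: SilvermanAEC2009, III.3.6] -/
theorem transl_neg_comp_transl : W.transl add (-R) ≫ W.transl add R = 𝟙 W.scheme := by
  simpa only [neg_neg] using W.transl_comp_transl_neg add hadd (-R)

include hadd in
/-- **`τ_R` is an isomorphism of `K`-schemes** (inverse `τ_{-R}`). [cite: SilvermanAEC2009, III.3.6] -/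
theorem isIso_transl : IsIso (W.transl add R) :=
  ⟨W.transl add (-R), W.transl_comp_transl_neg add hadd R, W.transl_neg_comp_transl add hadd R⟩

include hadd in
/-- The underlying morphism of schemes of `τ_R` is an isomorphism. [cite: SilvermanAEC2009, III.3.6] -/
theorem isIso_transl_left : IsIso (W.transl add R).left := by
  haveI := W.isIso_transl add hadd R
  exact inferInstanceAs (IsIso ((Over.forget _).map (W.transl add R)))

include hadd in
/-- An open immersion into `E_W` followed by a translation is an open immersion. [folklore] -/
theorem isOpenImmersion_comp_transl_left {U : Scheme.{u}} (ι : U ⟶ W.scheme.left) [IsOpenImmersion ι] :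
    IsOpenImmersion (ι ≫ (W.transl add R).left) := by
  haveI := W.isIso_transl_left add hadd R
  infer_instance

omit [W.IsElliptic] in
/-- `τ_R` is a morphism over `K` (the structure equation of its underlying morphism). [folklore] -/
theorem transl_left_over : (W.transl add R).left ≫ W.scheme.hom = W.scheme.hom := Over.w _

end Transl

end WeierstrassCurve

end
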